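import Mathlib.Algebra.Order.Chebyshev
import Mathlib.Analysis.Complex.Norm
import Mathlib.Algebra.BigOperators.Intervals

/-!
# `BalabanUV.Beta.GAN24.DirichletRingPoincare` — binder row G-an2-4 / (CONV-C), road P2 PART IV, leaf L6 of the ring lemma: THE LOCAL POINCARÉ
# INEQUALITY ON A LATTICE SQUARE MINUS A QUADRANT (unit b2b-balaban-gan24-p2, gen 24, v1)

HONEST FRAMING (cell contract, verbatim): «discharging `BetaPertH` makes Bałaban's UV stability UNCONDITIONAL — a real constructive-QFT
result; it is NOT the continuum limit and NOT the Clay problem.»  Pure lattice brick for the ring lemma of memo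
`HOME/b2b-balaban-gan24-p2/gen24/W-FULL-WEIGHTED.md` §3 (leaf L6), written on the `2k × 2k` grid of natural-number coordinates (the square `Q_k(c)`
around a re-entrant vertex `c`, re-indexed; the quadrant NOT in `Ω` is `{s ≥ k} × {t ≥ k}`, where the field vanishes):
 * `norm_sq_le_mul_sum_tele` — 1-D: if `g k = 0` and `s ≤ k ≤ K` then `‖g s‖² ≤ k·Σ_{r<K}‖g(r+1) − g r‖²` (telescope + Cauchy–Schwarz);
 * **`local_poincare_wedge`** — for `U : ℕ → ℕ → ℂ` vanishing on `[k,2k) × [k,2k)`: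
   `Σ_{s,t<2k}‖U s t‖² ≤ 3k²·( Σ_{s<2k−1, t<2k}‖U(s+1)t − U s t‖² + Σ_{s<2k, t<2k−1}‖U s(t+1) − U s t‖² )`
   (rows into the quadrant for `t ≥ k`, columns for `s ≥ k`, and for the opposite quarter a column leg of length `k` followed by a row — memo L6 with
   the constant improved from 6 to 3).
It bounds the source pairing `|Σ_{S_k} ū F| ≤ ‖u‖_{S_k}‖F‖_{S_k} ≤ √3·k·√E_k·‖F‖_{S_k}` in the ring recursion (L7, `DirichletRingGronwall`).

ABSOLUTE RULE (cell, verbatim): «No internally-minted statement may enter as a cited fact. Every hypothesis is either kernel-proved in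
this package or a verbatim quotation of a PUBLISHED theorem with page reference. The manuscript(s) under audit are NOT citable for
their own disputed steps — they are the thing under adjudication; programme-internal (2001/route/tribunal) claims are never citable.»
[folklore] finite sums; nothing printed is a hypothesis.  NOT CLAIMED: the ring lemma (L5, L8), (A)/(B), NE2, (CONV-C), `BetaPertH`, continuum, Clay.
«not in print; our proof attempt».  HONEST DEPENDENCY: continuum YM on T⁴ ⇐ BetaPertH ∧ nine spine estimates (0/9 proved); BetaPertH ⇐ (D1) ∧
(D4) ∧ CAP+tail; G-an2-4 gates asym, D1 and NE2/3/4.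
-/

noncomputable section

open scoped BigOperators
open Finset

namespace Summit.QuantumFields.BalabanUV.Beta.GAN24.DirichletRingPoincare

/-! ## §1 The 1-D telescope -/

/-- **1-D telescope + Cauchy–Schwarz**: if `g k = 0` and `s ≤ k ≤ K`, then `‖g s‖² ≤ (k − s)·Σ_{r<K}‖g(r+1) − g r‖²`. [folklore] -/
theorem norm_sq_le_mul_sum_tele (g : ℕ → ℂ) {s k K : ℕ} (hsk : s ≤ k) (hkK : k ≤ K) (hk : g k = 0) :
    ‖g s‖ ^ 2 ≤ ((k - s : ℕ) : ℝ) * ∑ r ∈ range K, ‖g (r + 1) - g r‖ ^ 2 := by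
  -- telescope: `g k − g s = Σ_{i<k−s} (g(s+i+1) − g(s+i))`
  have htel : ∑ i ∈ range (k - s), (g (s + i + 1) - g (s + i)) = g k - g s := by
    have h := Finset.sum_range_sub (fun i => g (s + i)) (k - s)
    rw [show s + (k - s) = k by omega, add_zero] at h
    rw [← h]
    refine Finset.sum_congr rfl fun i _ => ?_
    rw [add_assoc]
  have hgs : g s = -∑ i ∈ range (k - s), (g (s + i + 1) - g (s + i)) := by
    rw [htel, hk, zero_sub, neg_neg]
  have h1 : ‖g s‖ ≤ ∑ i ∈ range (k - s), ‖g (s + i + 1) - g (s + i)‖ := by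
    rw [hgs, norm_neg]
    exact norm_sum_le _ _
  have h2 : (∑ i ∈ range (k - s), ‖g (s + i + 1) - g (s + i)‖) ^ 2
      ≤ ((k - s : ℕ) : ℝ) * ∑ i ∈ range (k - s), ‖g (s + i + 1) - g (s + i)‖ ^ 2 := by
    have := sq_sum_le_card_mul_sum_sq (s := range (k - s)) (f := fun i => ‖g (s + i + 1) - g (s + i)‖)
    rwa [Finset.card_range] at this
  have h3 : ∑ i ∈ range (k - s), ‖g (s + i + 1) - g (s + i)‖ ^ 2 ≤ ∑ r ∈ range K, ‖g (r + 1) - g r‖ ^ 2 := by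
    have himg : ∑ i ∈ range (k - s), ‖g (s + i + 1) - g (s + i)‖ ^ 2
        = ∑ r ∈ (range (k - s)).image (fun i => s + i), ‖g (r + 1) - g r‖ ^ 2 := by
      rw [Finset.sum_image (fun a _ b _ h => by simpa using h)]
    rw [himg]
    refine Finset.sum_le_sum_of_subset_of_nonneg (fun r hr => ?_) (fun _ _ _ => sq_nonneg _)
    obtain ⟨i, hi, rfl⟩ := Finset.mem_image.mp hr
    have := Finset.mem_range.mp hi
    exact Finset.mem_range.mpr (by omega)
  have hS0 : 0 ≤ ∑ i ∈ range (k - s), ‖g (s + i + 1) - g (s + i)‖ ^ 2 := Finset.sum_nonneg fun _ _ => sq_nonneg _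
  calc ‖g s‖ ^ 2 ≤ (∑ i ∈ range (k - s), ‖g (s + i + 1) - g (s + i)‖) ^ 2 := pow_le_pow_left₀ (norm_nonneg _) h1 2
    _ ≤ ((k - s : ℕ) : ℝ) * ∑ i ∈ range (k - s), ‖g (s + i + 1) - g (s + i)‖ ^ 2 := h2
    _ ≤ ((k - s : ℕ) : ℝ) * ∑ r ∈ range K, ‖g (r + 1) - g r‖ ^ 2 := mul_le_mul_of_nonneg_left h3 (Nat.cast_nonneg _)

/-! ## §2 The local Poincaré inequality on the square minus the quadrant -/

/-- **THE LOCAL POINCARÉ INEQUALITY** (memo L6): for `k ≥ 1` and `U : ℕ → ℕ → ℂ` vanishing on the quadrant `[k,2k) × [k,2k)` of the `2k × 2k`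
square, `Σ_{s,t<2k}‖U s t‖² ≤ 3k²·(horizontal + vertical bond energies of the square)`. [folklore] -/
theorem local_poincare_wedge {k : ℕ} (hk : 1 ≤ k) (U : ℕ → ℕ → ℂ)
    (hU : ∀ s t, k ≤ s → s < 2 * k → k ≤ t → t < 2 * k → U s t = 0) :
    ∑ s ∈ range (2 * k), ∑ t ∈ range (2 * k), ‖U s t‖ ^ 2
      ≤ 3 * (k : ℝ) ^ 2 *
        (∑ s ∈ range (2 * k - 1), ∑ t ∈ range (2 * k), ‖U (s + 1) t - U s t‖ ^ 2
          + ∑ s ∈ range (2 * k), ∑ t ∈ range (2 * k - 1), ‖U s (t + 1) - U s t‖ ^ 2) := by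
  have hkR : (1 : ℝ) ≤ k := by exact_mod_cast hk
  -- row and column energies
  set H : ℕ → ℝ := fun t => ∑ s ∈ range (2 * k - 1), ‖U (s + 1) t - U s t‖ ^ 2 with hH
  set V : ℕ → ℝ := fun s => ∑ t ∈ range (2 * k - 1), ‖U s (t + 1) - U s t‖ ^ 2 with hV
  have hH0 : ∀ t, 0 ≤ H t := fun t => Finset.sum_nonneg fun _ _ => sq_nonneg _
  have hV0 : ∀ s, 0 ≤ V s := fun s => Finset.sum_nonneg fun _ _ => sq_nonneg _
  set EH : ℝ := ∑ t ∈ range (2 * k), H t with hEH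
  set EV : ℝ := ∑ s ∈ range (2 * k), V s with hEV
  have hEh : ∑ s ∈ range (2 * k - 1), ∑ t ∈ range (2 * k), ‖U (s + 1) t - U s t‖ ^ 2 = EH := by
    rw [hEH, Finset.sum_comm]
  have hEv : ∑ s ∈ range (2 * k), ∑ t ∈ range (2 * k - 1), ‖U s (t + 1) - U s t‖ ^ 2 = EV := rfl
  -- partial sums of `H`, `V` over the two halves are bounded by the totals
  have h2k : 2 * k = k + k := by ring
  have hHhi : ∑ t ∈ range k, H (k + t) ≤ EH := by
    rw [hEH, h2k, Finset.sum_range_add]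
    exact le_add_of_nonneg_left (Finset.sum_nonneg fun _ _ => hH0 _)
  have hVlo : ∑ s ∈ range k, V s ≤ EV := by
    rw [hEV, h2k, Finset.sum_range_add]
    exact le_add_of_nonneg_right (Finset.sum_nonneg fun _ _ => hV0 _)
  have hVhi : ∑ s ∈ range k, V (k + s) ≤ EV := by
    rw [hEV, h2k, Finset.sum_range_add]
    exact le_add_of_nonneg_left (Finset.sum_nonneg fun _ _ => hV0 _)
  -- (R1) `s < k ≤ t`: row telescope to `(k, t)`
  have hR1 : ∀ s t, s < k → k ≤ t → t < 2 * k → ‖U s t‖ ^ 2 ≤ (k : ℝ) * H t := by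
    intro s t hs ht ht2
    have h := norm_sq_le_mul_sum_tele (fun r => U r t) hs.le (show k ≤ 2 * k - 1 by omega) (hU k t le_rfl (by omega) ht ht2)
    have hc : ((k - s : ℕ) : ℝ) ≤ k := by exact_mod_cast Nat.sub_le k s
    exact h.trans (mul_le_mul_of_nonneg_right hc (hH0 t))
  -- (R2) `t < k ≤ s`: column telescope to `(s, k)`
  have hR2 : ∀ s t, k ≤ s → s < 2 * k → t < k → ‖U s t‖ ^ 2 ≤ (k : ℝ) * V s := by
    intro s t hs hs2 ht
    have h := norm_sq_le_mul_sum_tele (fun r => U s r) ht.le (show k ≤ 2 * k - 1 by omega) (hU s k hs hs2 le_rfl (by omega))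
    have hc : ((k - t : ℕ) : ℝ) ≤ k := by exact_mod_cast Nat.sub_le k t
    exact h.trans (mul_le_mul_of_nonneg_right hc (hV0 s))
  -- (R3) `s, t < k`: a column leg of length `k` to `(s, t+k)`, then (R1)
  have hR3 : ∀ s t, s < k → t < k → ‖U s t‖ ^ 2 ≤ 2 * ((k : ℝ) * V s) + 2 * ((k : ℝ) * H (k + t)) := by
    intro s t hs ht
    have hleg : ‖U s t - U s (t + k)‖ ^ 2 ≤ (k : ℝ) * V s := by
      have h := norm_sq_le_mul_sum_tele (fun r => U s r - U s (t + k)) (s := t) (k := t + k) (K := 2 * k - 1)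
        (by omega) (by omega) (sub_self _)
      have e : ∀ r, (U s (r + 1) - U s (t + k)) - (U s r - U s (t + k)) = U s (r + 1) - U s r := fun r => by ring
      simp only [e, show t + k - t = k by omega] at h
      exact h
    have hfar : ‖U s (t + k)‖ ^ 2 ≤ (k : ℝ) * H (k + t) := by
      rw [add_comm t k]
      exact hR1 s (k + t) hs (by omega) (by omega)
    have hsplit : ‖U s t‖ ^ 2 ≤ 2 * ‖U s t - U s (t + k)‖ ^ 2 + 2 * ‖U s (t + k)‖ ^ 2 := by
      have e : U s t = (U s t - U s (t + k)) + U s (t + k) := by ring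
      have h := norm_add_le (U s t - U s (t + k)) (U s (t + k))
      rw [← e] at h
      nlinarith [h, norm_nonneg (U s t - U s (t + k)), norm_nonneg (U s (t + k)), norm_nonneg (U s t),
        sq_nonneg (‖U s t - U s (t + k)‖ - ‖U s (t + k)‖)]
    linarith [hsplit, hleg, hfar]
  -- the four quarter sums
  have hsplit2 : ∑ s ∈ range (2 * k), ∑ t ∈ range (2 * k), ‖U s t‖ ^ 2
      = ∑ s ∈ range k, ∑ t ∈ range k, ‖U s t‖ ^ 2 + ∑ s ∈ range k, ∑ t ∈ range k, ‖U s (k + t)‖ ^ 2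
        + (∑ s ∈ range k, ∑ t ∈ range k, ‖U (k + s) t‖ ^ 2 + ∑ s ∈ range k, ∑ t ∈ range k, ‖U (k + s) (k + t)‖ ^ 2) := by
    rw [h2k, Finset.sum_range_add]
    congr 1
    · rw [← Finset.sum_add_distrib]
      refine Finset.sum_congr rfl fun s _ => ?_
      rw [Finset.sum_range_add]
    · rw [← Finset.sum_add_distrib]
      refine Finset.sum_congr rfl fun s _ => ?_
      rw [Finset.sum_range_add]
  -- generic bookkeeping: a double sum over `range k × range k` of `a s + b t`
  have hsum2 : ∀ (a b : ℕ → ℝ), ∑ s ∈ range k, ∑ t ∈ range k, (a s + b t) = (k : ℝ) * ∑ s ∈ range k, a s + (k : ℝ) * ∑ t ∈ range k, b t := by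
    intro a b
    have hb : ∀ s ∈ range k, ∑ t ∈ range k, (a s + b t) = (k : ℝ) * a s + ∑ t ∈ range k, b t := by
      intro s _
      rw [Finset.sum_add_distrib, Finset.sum_const, Finset.card_range, nsmul_eq_mul]
    rw [Finset.sum_congr rfl hb, Finset.sum_add_distrib, Finset.sum_const, Finset.card_range, nsmul_eq_mul]
    simp only [Finset.mul_sum]
  have hQ33 : ∑ s ∈ range k, ∑ t ∈ range k, ‖U s t‖ ^ 2 ≤ 2 * (k : ℝ) ^ 2 * EV + 2 * (k : ℝ) ^ 2 * EH := by
    have h1 : ∑ s ∈ range k, ∑ t ∈ range k, ‖U s t‖ ^ 2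
        ≤ ∑ s ∈ range k, ∑ t ∈ range k, (2 * ((k : ℝ) * V s) + 2 * ((k : ℝ) * H (k + t))) :=
      Finset.sum_le_sum fun s hs => Finset.sum_le_sum fun t ht => hR3 s t (Finset.mem_range.mp hs) (Finset.mem_range.mp ht)
    rw [hsum2 (fun s => 2 * ((k : ℝ) * V s)) (fun t => 2 * ((k : ℝ) * H (k + t))), ← Finset.mul_sum, ← Finset.mul_sum,
      ← Finset.mul_sum, ← Finset.mul_sum] at h1
    nlinarith [h1, hVlo, hHhi, hkR, Finset.sum_nonneg (fun s (_ : s ∈ range k) => hV0 s),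
      Finset.sum_nonneg (fun t (_ : t ∈ range k) => hH0 (k + t))]
  have hQ31 : ∑ s ∈ range k, ∑ t ∈ range k, ‖U s (k + t)‖ ^ 2 ≤ (k : ℝ) ^ 2 * EH := by
    have h1 : ∑ s ∈ range k, ∑ t ∈ range k, ‖U s (k + t)‖ ^ 2 ≤ ∑ s ∈ range k, ∑ t ∈ range k, (0 + (k : ℝ) * H (k + t)) :=
      Finset.sum_le_sum fun s hs => Finset.sum_le_sum fun t ht => by
        rw [zero_add]; exact hR1 s (k + t) (Finset.mem_range.mp hs) (by omega) (by have := Finset.mem_range.mp ht; omega)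
    rw [hsum2 (fun _ => (0 : ℝ)) (fun t => (k : ℝ) * H (k + t)), ← Finset.mul_sum] at h1
    simp only [Finset.sum_const_zero, mul_zero, zero_add] at h1
    nlinarith [h1, hHhi, hkR, Finset.sum_nonneg (fun t (_ : t ∈ range k) => hH0 (k + t))]
  have hQ32 : ∑ s ∈ range k, ∑ t ∈ range k, ‖U (k + s) t‖ ^ 2 ≤ (k : ℝ) ^ 2 * EV := by
    have h1 : ∑ s ∈ range k, ∑ t ∈ range k, ‖U (k + s) t‖ ^ 2 ≤ ∑ s ∈ range k, ∑ t ∈ range k, ((k : ℝ) * V (k + s) + 0) :=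
      Finset.sum_le_sum fun s hs => Finset.sum_le_sum fun t ht => by
        rw [add_zero]; exact hR2 (k + s) t (by omega) (by have := Finset.mem_range.mp hs; omega) (Finset.mem_range.mp ht)
    rw [hsum2 (fun s => (k : ℝ) * V (k + s)) (fun _ => (0 : ℝ)), ← Finset.mul_sum] at h1
    simp only [Finset.sum_const_zero, mul_zero, add_zero] at h1
    nlinarith [h1, hVhi, hkR, Finset.sum_nonneg (fun s (_ : s ∈ range k) => hV0 (k + s))]
  have hQ34 : ∑ s ∈ range k, ∑ t ∈ range k, ‖U (k + s) (k + t)‖ ^ 2 = 0 := by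
    refine Finset.sum_eq_zero fun s hs => Finset.sum_eq_zero fun t ht => ?_
    have hs' := Finset.mem_range.mp hs
    have ht' := Finset.mem_range.mp ht
    rw [hU (k + s) (k + t) (by omega) (by omega) (by omega) (by omega), norm_zero, zero_pow two_ne_zero]
  rw [hsplit2]
  have hEH0 : 0 ≤ EH := Finset.sum_nonneg fun _ _ => hH0 _
  have hEV0 : 0 ≤ EV := Finset.sum_nonneg fun _ _ => hV0 _
  nlinarith [hQ33, hQ31, hQ32, hQ34, hEH0, hEV0, hkR]

end Summit.QuantumFields.BalabanUV.Beta.GAN24.DirichletRingPoincare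

end
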